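import Summits.Ventures.PercRepro.S1LowRankExtension

/-!
# PercRepro — THE SHAPE `(rank 5 on 9) ⊕ (rank 3 on 5)` OF THE `(8, 6)` CELL (p2, gen 28; SUBCLAIM-S1 §6.10
(xvii)(p); PARTIAL — towards the `(8, 6)` capstone)

`M` coloop-free of rank `5` on `9` points (a corank-`4` part), `N` coloop-free of rank `3` on `5` points, all pairs
of rank `2`. The complements by size: `N_M(5, 4) ≤ s₅`, `N_M(5, 3) ≤ q₃ + s₆`, `N_M(5, 2) ≤ q₂ + t + s₇`;
`#U ≤ N_M(5, 4) + 5 N_M(5, 3) + 10 N_M(5, 2)`; `#Y ≥ 13 f_M(2) + 23 f_M(3) + 28 f_M(4) + 16 f_M(5)` with the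
rank profile by sizes (`f_M(2) ≥ 36 + t + q₂`, `f_M(3) ≥ 84 − t + q₃ + r₅₃ + r₆₃`, `f_M(4) ≥ u₄ + r₅₄ + r₆₄ + r₇₄`,
`f_M(5) ≥ 10 + s₅ + s₆ + s₇`, the `k`-sets partitioned by rank), the extension incidence (`q₂ + q₃ ≤ 126 − s₅`:
a rank-`≤ 3` four-set kills its five extensions) and the rank-`2` counts `t ≤ 36`, `q₂ ≤ 18`, `p₅ ≤ 3`:
`Φ(8, 4) · #U ≤ #Y` (margin `≥ 250`). Nothing is claimed about any cell.

* the ranks by size on `9` points of rank `5`; `c025_eight_four_disjointSum_five_nine_three_five`.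
Axioms: standard.
-/

open scoped Matroid

namespace PercRepro

namespace S1

open Set

variable {α : Type}

section RankFiveOnNine

variable {M : Matroid α} [M.Finite]

/-- The rank of a `k`-set as a natural with its bounds: `2 ≤ n ≤ min(k, 5)` and `k ≥ 9 − (5 − n + 1)` for `n < 5`. -/
theorem eRk_bounds_rank_five_nine (hM : M.eRank = ((5 : ℕ) : ℕ∞)) (hE : M.E.ncard = 9) (hcol : M.coloops = ∅)
    (hpairs : ∀ e ∈ M.E, ∀ f ∈ M.E, e ≠ f → M.eRk {e, f} = 2) {X : Set α} (hX : X ⊆ M.E) (h2 : 2 ≤ X.ncard) :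
    ∃ n : ℕ, M.eRk X = (n : ℕ∞) ∧ 2 ≤ n ∧ n ≤ 5 ∧ n ≤ X.ncard ∧ (n < 5 → X.ncard + (5 - n + 1) ≤ 9) := by
  have hhi : M.eRk X ≤ M.eRank := M.eRk_le_eRank X
  rw [hM] at hhi
  obtain ⟨n, hn⟩ := ENat.ne_top_iff_exists.mp (ne_top_of_le_ne_top (by decide) hhi)
  have hlo := two_le_eRk_of_two_le_ncard hpairs hX h2
  have hsize : M.eRk X ≤ (X.ncard : ℕ∞) := by
    have := M.eRk_le_encard X
    rwa [← (M.ground_finite.subset hX).cast_ncard_eq] at this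
  rw [← hn] at hlo hhi hsize
  refine ⟨n, hn.symm, by exact_mod_cast hlo, by exact_mod_cast hhi, by exact_mod_cast hsize, fun h => ?_⟩
  have hmiss := sub_add_one_le_ncard_ground_sdiff_of_coloops M hM hcol hX hn.symm h
  rw [ncard_sdiff' hX M.ground_finite, hE] at hmiss
  have := ncard_le_ncard hX M.ground_finite
  rw [hE] at this
  omega


/-- The `k`-sets of rank exactly `n`. -/
def rkSets (M : Matroid α) (k n : ℕ) : Set (Set α) :=
  {Q : Set α | Q ⊆ M.E ∧ Q.ncard = k ∧ M.eRk Q = (n : ℕ∞)}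

/-- The `k`-sets of rank `n` are finite. -/
theorem rkSets_finite (k n : ℕ) : (rkSets M k n).Finite :=
  M.ground_finite.finite_subsets.subset (fun _ hQ => hQ.1)

omit [M.Finite] in
/-- The `k`-sets of rank `n` lie in the rank level `n`. -/
theorem rkSets_subset_rankSet (k n : ℕ) : rkSets M k n ⊆ rankSet M n := fun _ hQ => ⟨hQ.1, hQ.2.2⟩

/-- The number of `k`-sets on `9` points. -/
theorem ncard_kSets (hE : M.E.ncard = 9) (k : ℕ) : {A : Set α | A ⊆ M.E ∧ A.ncard = k}.ncard = Nat.choose 9 k := by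
  rw [ncard_setOf_subset_ncard_eq M.ground_finite k, hE]

/-- A `k`-set (`2 ≤ k ≤ 9`) lies in `rankTwoSets k ∪ rkSets k 3 ∪ rkSets k 4 ∪ rkSets k 5`. -/
theorem mem_rank_classes (hM : M.eRank = ((5 : ℕ) : ℕ∞)) (hE : M.E.ncard = 9) (hcol : M.coloops = ∅)
    (hpairs : ∀ e ∈ M.E, ∀ f ∈ M.E, e ≠ f → M.eRk {e, f} = 2) {X : Set α} (hX : X ⊆ M.E) (h2 : 2 ≤ X.ncard) :
    X ∈ rankTwoSets M X.ncard ∪ rkSets M X.ncard 3 ∪ rkSets M X.ncard 4 ∪ rkSets M X.ncard 5 := by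
  obtain ⟨n, hn, hn2, hn5, -, -⟩ := eRk_bounds_rank_five_nine hM hE hcol hpairs hX h2
  rcases Nat.lt_or_ge n 3 with h | h
  · left; left; left; refine ⟨hX, rfl, ?_⟩; rw [hn]; have : n = 2 := by omega
    rw [this]; rfl
  rcases Nat.lt_or_ge n 4 with h' | h'
  · left; left; right; refine ⟨hX, rfl, ?_⟩; rw [hn]; have : n = 3 := by omega
    rw [this]
  rcases Nat.lt_or_ge n 5 with h'' | h''
  · left; right; refine ⟨hX, rfl, ?_⟩; rw [hn]; have : n = 4 := by omega
    rw [this]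
  · right; refine ⟨hX, rfl, ?_⟩; rw [hn]; have : n = 5 := by omega
    rw [this]

/-- The `k`-sets are covered by the four rank classes: `C(9, k) ≤ t_k + r_{k3} + r_{k4} + s_k`. -/
theorem choose_le_rank_classes (hM : M.eRank = ((5 : ℕ) : ℕ∞)) (hE : M.E.ncard = 9) (hcol : M.coloops = ∅)
    (hpairs : ∀ e ∈ M.E, ∀ f ∈ M.E, e ≠ f → M.eRk {e, f} = 2) (k : ℕ) (hk : 2 ≤ k) :
    Nat.choose 9 k ≤ (rankTwoSets M k).ncard + (rkSets M k 3).ncard + (rkSets M k 4).ncard + (rkSets M k 5).ncard := by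
  have hsub : {A : Set α | A ⊆ M.E ∧ A.ncard = k} ⊆
      rankTwoSets M k ∪ rkSets M k 3 ∪ rkSets M k 4 ∪ rkSets M k 5 := by
    rintro A ⟨hAE, hAk⟩
    have := mem_rank_classes hM hE hcol hpairs hAE (by omega)
    rwa [hAk] at this
  have h := ncard_le_ncard hsub (((rankTwoSets_finite M k).union (rkSets_finite k 3)).union (rkSets_finite k 4) |>.union
    (rkSets_finite k 5))
  rw [ncard_kSets hE] at h
  refine h.trans ((ncard_union_le _ _).trans ?_)
  exact Nat.add_le_add_right ((ncard_union_le _ _).trans (Nat.add_le_add_right (ncard_union_le _ _) _)) _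

/-- No rank-`2` sets of size `≥ 6`, no rank-`3` sets of size `≥ 7`, no rank-`4` sets of size `≥ 8`. -/
theorem rkSets_eq_empty_of_big (hM : M.eRank = ((5 : ℕ) : ℕ∞)) (hE : M.E.ncard = 9) (hcol : M.coloops = ∅)
    {k n : ℕ} (hn : n < 5) (hk : 9 < k + (5 - n + 1)) : rkSets M k n = ∅ := by
  rw [eq_empty_iff_forall_notMem]
  rintro X ⟨hXE, hXk, hXn⟩
  have hmiss := sub_add_one_le_ncard_ground_sdiff_of_coloops M hM hcol hXE hXn hn
  rw [ncard_sdiff' hXE M.ground_finite, hE, hXk] at hmiss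
  have := ncard_le_ncard hXE M.ground_finite
  rw [hE] at this
  omega

/-- No `k`-set has rank `n > k`. -/
theorem rkSets_eq_empty_of_lt {k n : ℕ} (hk : k < n) : rkSets M k n = ∅ := by
  rw [eq_empty_iff_forall_notMem]
  rintro X ⟨hXE, hXk, hXn⟩
  have := M.eRk_le_encard X
  rw [hXn, ← (M.ground_finite.subset hXE).cast_ncard_eq, hXk] at this
  have h' : n ≤ k := by exact_mod_cast this
  omega

/-- No rank-`2` set has more than `5` points. -/
theorem rankTwoSets_eq_empty_of_big (hM : M.eRank = ((5 : ℕ) : ℕ∞)) (hE : M.E.ncard = 9) (hcol : M.coloops = ∅)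
    {k : ℕ} (hk : 5 < k) : rankTwoSets M k = ∅ := by
  rw [eq_empty_iff_forall_notMem]
  rintro X ⟨hXE, hXk, hX2⟩
  have hX2' : M.eRk X = ((2 : ℕ) : ℕ∞) := hX2
  have hmiss := sub_add_one_le_ncard_ground_sdiff_of_coloops M hM hcol hXE hX2' (by norm_num)
  rw [ncard_sdiff' hXE M.ground_finite, hE, hXk] at hmiss
  have := ncard_le_ncard hXE M.ground_finite
  rw [hE] at this
  omega

/-- `f(2) ≥ 36 + t + q₂`. -/
theorem f2_ge_rank_five_nine (hE : M.E.ncard = 9) (hpairs : ∀ e ∈ M.E, ∀ f ∈ M.E, e ≠ f → M.eRk {e, f} = 2) :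
    36 + (rankTwoSets M 3).ncard + (rankTwoSets M 4).ncard ≤ (rankSet M 2).ncard := by
  have hf2 : {A : Set α | A ⊆ M.E ∧ A.ncard = 2}.Finite := M.ground_finite.finite_subsets.subset (fun _ hA => hA.1)
  have hsub : {A : Set α | A ⊆ M.E ∧ A.ncard = 2} ∪ rankTwoSets M 3 ∪ rankTwoSets M 4 ⊆ rankSet M 2 := by
    rintro A ((⟨hAE, h2⟩ | ⟨hAE, -, h⟩) | ⟨hAE, -, h⟩)
    · refine ⟨hAE, ?_⟩
      obtain ⟨x, y, hxy, rfl⟩ := ncard_eq_two.mp h2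
      rw [hpairs x (hAE (by simp)) y (hAE (by simp)) hxy]; rfl
    · exact ⟨hAE, h⟩
    · exact ⟨hAE, h⟩
  have h := ncard_le_ncard hsub (rankSet_finite M 2)
  rw [ncard_union_eq (by rw [Set.disjoint_left]; rintro A (⟨-, h2⟩ | ⟨-, h3, -⟩) ⟨-, h4, -⟩ <;> omega)
      ((hf2.union (rankTwoSets_finite M 3))) (rankTwoSets_finite M 4),
    ncard_union_eq (by rw [Set.disjoint_left]; rintro A ⟨-, h2⟩ ⟨-, h3, -⟩; omega) hf2 (rankTwoSets_finite M 3),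
    ncard_kSets hE, show Nat.choose 9 2 = 36 by decide] at h
  exact h

/-- `f(3) ≥ (84 − t) + q₃ + r₅₃ + r₆₃`, `f(4) ≥ u₄ + r₅₄ + r₆₄ + r₇₄`, `f(5) ≥ 10 + s₅ + s₆ + s₇`. -/
theorem f345_ge_rank_five_nine (hM : M.eRank = ((5 : ℕ) : ℕ∞)) (hE : M.E.ncard = 9) (hcol : M.coloops = ∅)
    (hpairs : ∀ e ∈ M.E, ∀ f ∈ M.E, e ≠ f → M.eRk {e, f} = 2) :
    (84 - (rankTwoSets M 3).ncard) + (rkSets M 4 3).ncard + (rkSets M 5 3).ncard + (rkSets M 6 3).ncard ≤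
      (rankSet M 3).ncard ∧
    (rkSets M 4 4).ncard + (rkSets M 5 4).ncard + (rkSets M 6 4).ncard + (rkSets M 7 4).ncard ≤ (rankSet M 4).ncard ∧
    10 + (rkSets M 5 5).ncard + (rkSets M 6 5).ncard + (rkSets M 7 5).ncard ≤ (rankSet M 5).ncard := by
  refine ⟨?_, ?_, ?_⟩
  · -- the `3`-sets of rank `3` are all `3`-sets but the rank-`2` triples
    have h3 : (rkSets M 3 3).ncard + (rankTwoSets M 3).ncard ≥ 84 := by
      have := choose_le_rank_classes hM hE hcol hpairs 3 (by norm_num)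
      rw [rkSets_eq_empty_of_lt (M := M) (k := 3) (n := 4) (by norm_num),
        rkSets_eq_empty_of_lt (M := M) (k := 3) (n := 5) (by norm_num), ncard_empty,
        show Nat.choose 9 3 = 84 by decide] at this
      omega
    have hsub : rkSets M 3 3 ∪ rkSets M 4 3 ∪ rkSets M 5 3 ∪ rkSets M 6 3 ⊆ rankSet M 3 := by
      rintro A (((hA | hA) | hA) | hA) <;> exact rkSets_subset_rankSet _ _ hA
    have h := ncard_le_ncard hsub (rankSet_finite M 3)
    rw [ncard_union_eq (by rw [Set.disjoint_left]; rintro A ((⟨-, h3', -⟩ | ⟨-, h4', -⟩) | ⟨-, h5', -⟩) ⟨-, h6', -⟩ <;> omega)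
        (((rkSets_finite 3 3).union (rkSets_finite 4 3)).union (rkSets_finite 5 3)) (rkSets_finite 6 3),
      ncard_union_eq (by rw [Set.disjoint_left]; rintro A (⟨-, h3', -⟩ | ⟨-, h4', -⟩) ⟨-, h5', -⟩ <;> omega)
        ((rkSets_finite 3 3).union (rkSets_finite 4 3)) (rkSets_finite 5 3),
      ncard_union_eq (by rw [Set.disjoint_left]; rintro A ⟨-, h3', -⟩ ⟨-, h4', -⟩; omega) (rkSets_finite 3 3)
        (rkSets_finite 4 3)] at h
    omega
  · have hsub : rkSets M 4 4 ∪ rkSets M 5 4 ∪ rkSets M 6 4 ∪ rkSets M 7 4 ⊆ rankSet M 4 := by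
      rintro A (((hA | hA) | hA) | hA) <;> exact rkSets_subset_rankSet _ _ hA
    have h := ncard_le_ncard hsub (rankSet_finite M 4)
    rw [ncard_union_eq (by rw [Set.disjoint_left]; rintro A ((⟨-, h4', -⟩ | ⟨-, h5', -⟩) | ⟨-, h6', -⟩) ⟨-, h7', -⟩ <;> omega)
        (((rkSets_finite 4 4).union (rkSets_finite 5 4)).union (rkSets_finite 6 4)) (rkSets_finite 7 4),
      ncard_union_eq (by rw [Set.disjoint_left]; rintro A (⟨-, h4', -⟩ | ⟨-, h5', -⟩) ⟨-, h6', -⟩ <;> omega)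
        ((rkSets_finite 4 4).union (rkSets_finite 5 4)) (rkSets_finite 6 4),
      ncard_union_eq (by rw [Set.disjoint_left]; rintro A ⟨-, h4', -⟩ ⟨-, h5', -⟩; omega) (rkSets_finite 4 4)
        (rkSets_finite 5 4)] at h
    exact h
  · -- `E`, the nine `8`-sets (all span), the spanning `5`-, `6`-, `7`-sets
    have h8 : (rkSets M 8 5).ncard ≥ 9 := by
      have := choose_le_rank_classes hM hE hcol hpairs 8 (by norm_num)
      rw [rankTwoSets_eq_empty_of_big hM hE hcol (k := 8) (by norm_num),
        rkSets_eq_empty_of_big hM hE hcol (k := 8) (n := 3) (by norm_num) (by norm_num),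
        rkSets_eq_empty_of_big hM hE hcol (k := 8) (n := 4) (by norm_num) (by norm_num), ncard_empty,
        show Nat.choose 9 8 = 9 by decide] at this
      omega
    have hsub : {M.E} ∪ rkSets M 8 5 ∪ rkSets M 5 5 ∪ rkSets M 6 5 ∪ rkSets M 7 5 ⊆ rankSet M 5 := by
      rintro A ((((hA | hA) | hA) | hA) | hA)
      · rw [mem_singleton_iff] at hA; subst hA
        exact ⟨subset_rfl, by rw [M.eRk_ground, hM]⟩
      all_goals exact rkSets_subset_rankSet _ _ hA
    have hE9 : Disjoint ({M.E} : Set (Set α)) (rkSets M 8 5) := by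
      rw [Set.disjoint_left]
      rintro A hA ⟨-, h8', -⟩
      rw [mem_singleton_iff] at hA; subst hA; omega
    have h := ncard_le_ncard hsub (rankSet_finite M 5)
    rw [ncard_union_eq (by
          rw [Set.disjoint_left]
          rintro A (((hA | ⟨-, h8', -⟩) | ⟨-, h5', -⟩) | ⟨-, h6', -⟩) ⟨-, h7', -⟩
          · rw [mem_singleton_iff] at hA; subst hA; omega
          all_goals omega) ((((finite_singleton _).union (rkSets_finite 8 5)).union (rkSets_finite 5 5)).union
          (rkSets_finite 6 5)) (rkSets_finite 7 5),
      ncard_union_eq (by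
          rw [Set.disjoint_left]
          rintro A ((hA | ⟨-, h8', -⟩) | ⟨-, h5', -⟩) ⟨-, h6', -⟩
          · rw [mem_singleton_iff] at hA; subst hA; omega
          all_goals omega) (((finite_singleton _).union (rkSets_finite 8 5)).union (rkSets_finite 5 5))
          (rkSets_finite 6 5),
      ncard_union_eq (by
          rw [Set.disjoint_left]
          rintro A (hA | ⟨-, h8', -⟩) ⟨-, h5', -⟩
          · rw [mem_singleton_iff] at hA; subst hA; omega
          · omega) ((finite_singleton _).union (rkSets_finite 8 5)) (rkSets_finite 5 5),
      ncard_union_eq hE9 (finite_singleton _) (rkSets_finite 8 5), ncard_singleton] at h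
    omega

/-- The partitions of the `4`-, `5`-, `6`-, `7`-sets by rank (as lower bounds). -/
theorem partitions_rank_five_nine (hM : M.eRank = ((5 : ℕ) : ℕ∞)) (hE : M.E.ncard = 9) (hcol : M.coloops = ∅)
    (hpairs : ∀ e ∈ M.E, ∀ f ∈ M.E, e ≠ f → M.eRk {e, f} = 2) :
    126 ≤ (rankTwoSets M 4).ncard + (rkSets M 4 3).ncard + (rkSets M 4 4).ncard ∧
    126 ≤ (rankTwoSets M 5).ncard + (rkSets M 5 3).ncard + (rkSets M 5 4).ncard + (rkSets M 5 5).ncard ∧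
    84 ≤ (rkSets M 6 3).ncard + (rkSets M 6 4).ncard + (rkSets M 6 5).ncard ∧
    36 ≤ (rkSets M 7 4).ncard + (rkSets M 7 5).ncard := by
  refine ⟨?_, ?_, ?_, ?_⟩
  · have := choose_le_rank_classes hM hE hcol hpairs 4 (by norm_num)
    rw [rkSets_eq_empty_of_lt (M := M) (k := 4) (n := 5) (by norm_num), ncard_empty,
      show Nat.choose 9 4 = 126 by decide] at this
    omega
  · have := choose_le_rank_classes hM hE hcol hpairs 5 (by norm_num)
    rw [show Nat.choose 9 5 = 126 by decide] at this
    exact this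
  · have := choose_le_rank_classes hM hE hcol hpairs 6 (by norm_num)
    rw [rankTwoSets_eq_empty_of_big hM hE hcol (k := 6) (by norm_num), ncard_empty,
      show Nat.choose 9 6 = 84 by decide] at this
    omega
  · have := choose_le_rank_classes hM hE hcol hpairs 7 (by norm_num)
    rw [rankTwoSets_eq_empty_of_big hM hE hcol (k := 7) (by norm_num),
      rkSets_eq_empty_of_big hM hE hcol (k := 7) (n := 3) (by norm_num) (by norm_num), ncard_empty,
      show Nat.choose 9 7 = 36 by decide] at this
    omega

end RankFiveOnNine

end S1

end PercRepro
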